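import Mathlib
import HarnessLib
import Summits.ValiantsHypothesis.ValiantsHypothesis.Theorems.MonotoneRestorationOrbitRestorationQPSmlAffineRestoration
import Summits.ValiantsHypothesis.ValiantsHypothesis.Theorems.MonotoneRestorationOrbitRestorationQPSmlRowRestoration

/-!
# The affine ROW-set-multilinear stratum of A_∞ and the two-sided affine set-multilinear stratum
(crux `OrbitRestorationQP`, stmt-ValiantsHypothesis-18293 — lane SML of stub A_∞ `stub_sigmaPiSigmaValue`)

Transpose twin of `SmlAffineRestoration.affineColSml_restoration` (flat cost `+3`, `Transpose.qpOrbitRestorable_of_transpose`):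

* `rename_swap_affineRowSml` — the transpose of an affine row-set-multilinear expression
  `Σ_t Π_a (β_{t,a} + Σ_b α_{t,a,b} x_{(a,b)})` is the affine column-set-multilinear expression with the same tables;
* `affineRowSml_restoration` — **a matrix-symmetric family with affine ROW-set-multilinear `ΣΠΣ` circuits of at most
  `n^c + c` product gates is quasi-polynomially orbit-restorable;**
* `affineSml_restoration` — both sides in one statement (at each level the circuit may be column- or row-set-multilinear,
  with constants).

Honest label: bookkeeping over landed theorems; a stratum of the off-path sub-rung A_∞; the stub itself, the crux and VP ≠ VNP
are not touched. [folklore]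
-/

noncomputable section

open scoped Classical

-- `Summit.ValiantsHypothesis.ValiantsHypothesis.…` is the tree's single-conjunct layout (Sub = Summit).
set_option linter.dupNamespace false

namespace Summit.ValiantsHypothesis.ValiantsHypothesis.Theorems.SmlAffineRestoration

open MvPolynomial Finset Equiv OrbitRestorationQPDepthThreeRung SmlRestoration

/-- **Transpose of an affine row-set-multilinear expression.** [folklore] -/
theorem rename_swap_affineRowSml {n s : ℕ} (β : Fin s → Fin n → ℂ) (α : Fin s → Fin n → Fin n → ℂ) :
    rename (Prod.swap : Fin n × Fin n → Fin n × Fin n)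
        (∑ t : Fin s, ∏ a : Fin n, (C (β t a) + ∑ b : Fin n, C (α t a b) * X (a, b)) : MvPolynomial (Fin n × Fin n) ℂ) =
      ∑ t : Fin s, ∏ b : Fin n, (C (β t b) + ∑ a : Fin n, C (α t b a) * X (a, b)) := by
  simp only [map_sum, map_prod, map_add, map_mul, rename_C, rename_X, Prod.swap_prod_mk]

/-- **THE AFFINE ROW-SET-MULTILINEAR STRATUM OF A_∞** (transpose of `affineColSml_restoration`, constant `+3`). [folklore] -/
theorem affineRowSml_restoration :
    ∀ f : (n : ℕ) → MvPolynomial (Fin n × Fin n) ℂ, IsMatrixSymmetric f →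
      (∃ c : ℕ, ∀ n : ℕ, ∃ (s : ℕ) (β : Fin s → Fin n → ℂ) (α : Fin s → Fin n → Fin n → ℂ), s ≤ n ^ c + c ∧
        f n = ∑ t : Fin s, ∏ a : Fin n, (C (β t a) + ∑ b : Fin n, C (α t a b) * X (a, b))) →
      ∃ c' : ℕ, ∀ n : ℕ, QPOrbitRestorable c' n (f n) := by
  intro f hsym ⟨c, hcirc⟩
  have hT : ∃ c₁ : ℕ, ∀ n : ℕ, ∃ (s : ℕ) (β : Fin s → Fin n → ℂ) (α : Fin s → Fin n → Fin n → ℂ), s ≤ n ^ c₁ + c₁ ∧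
      rename (Prod.swap : Fin n × Fin n → Fin n × Fin n) (f n) =
        ∑ t : Fin s, ∏ b : Fin n, (C (β t b) + ∑ a : Fin n, C (α t b a) * X (a, b)) := by
    refine ⟨c, fun n => ?_⟩
    obtain ⟨s, β, α, hs, hf⟩ := hcirc n
    exact ⟨s, β, α, hs, by rw [hf, rename_swap_affineRowSml]⟩
  obtain ⟨c', hc'⟩ := affineColSml_restoration _ (isMatrixSymmetric_transpose hsym) hT
  exact ⟨c' + 3, fun n => Transpose.qpOrbitRestorable_of_transpose (hc' n)⟩

/-- **THE AFFINE SET-MULTILINEAR STRATUM, BOTH SIDES.**  A matrix-symmetric family each of whose members has an affine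
column- OR row-set-multilinear `ΣΠΣ` circuit with at most `n^c + c` product gates (the side may depend on the level) is
quasi-polynomially orbit-restorable. [folklore] -/
theorem affineSml_restoration :
    ∀ f : (n : ℕ) → MvPolynomial (Fin n × Fin n) ℂ, IsMatrixSymmetric f →
      (∃ c : ℕ, ∀ n : ℕ, ∃ (s : ℕ) (β : Fin s → Fin n → ℂ) (α : Fin s → Fin n → Fin n → ℂ), s ≤ n ^ c + c ∧
        (f n = ∑ t : Fin s, ∏ b : Fin n, (C (β t b) + ∑ a : Fin n, C (α t b a) * X (a, b)) ∨
         f n = ∑ t : Fin s, ∏ a : Fin n, (C (β t a) + ∑ b : Fin n, C (α t a b) * X (a, b)))) →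
      ∃ c' : ℕ, ∀ n : ℕ, QPOrbitRestorable c' n (f n) := by
  intro f hsym ⟨c, hcirc⟩
  -- the column-sml levels and the row-sml levels, as two matrix-symmetric families (zero elsewhere)
  let P : ℕ → Prop := fun n => ∃ (s : ℕ) (β : Fin s → Fin n → ℂ) (α : Fin s → Fin n → Fin n → ℂ), s ≤ n ^ c + c ∧
    f n = ∑ t : Fin s, ∏ b : Fin n, (C (β t b) + ∑ a : Fin n, C (α t b a) * X (a, b))
  have hcol : ∀ n, ∃ (s : ℕ) (β : Fin s → Fin n → ℂ) (α : Fin s → Fin n → Fin n → ℂ), s ≤ n ^ c + c ∧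
      (if P n then f n else 0) = ∑ t : Fin s, ∏ b : Fin n, (C (β t b) + ∑ a : Fin n, C (α t b a) * X (a, b)) := by
    intro n
    by_cases h : P n
    · obtain ⟨s, β, α, hs, hf⟩ := h
      exact ⟨s, β, α, hs, by rw [if_pos (show P n from ⟨s, β, α, hs, hf⟩), hf]⟩
    · refine ⟨0, fun _ _ => 0, fun _ _ _ => 0, Nat.zero_le _, ?_⟩
      rw [if_neg h]; simp
  have hrow : ∀ n, ∃ (s : ℕ) (β : Fin s → Fin n → ℂ) (α : Fin s → Fin n → Fin n → ℂ), s ≤ n ^ c + c ∧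
      (if P n then (0 : MvPolynomial (Fin n × Fin n) ℂ) else f n) =
        ∑ t : Fin s, ∏ a : Fin n, (C (β t a) + ∑ b : Fin n, C (α t a b) * X (a, b)) := by
    intro n
    by_cases h : P n
    · refine ⟨0, fun _ _ => 0, fun _ _ _ => 0, Nat.zero_le _, ?_⟩
      rw [if_pos h]; simp
    · obtain ⟨s, β, α, hs, hf⟩ := hcirc n
      rcases hf with hf | hf
      · exact absurd ⟨s, β, α, hs, hf⟩ h
      · exact ⟨s, β, α, hs, by rw [if_neg h, hf]⟩
  have hsymIf : IsMatrixSymmetric fun n => if P n then f n else 0 := by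
    intro n σ τ
    by_cases h : P n
    · simp only [if_pos h]; exact hsym n σ τ
    · simp only [if_neg h, map_zero]
  have hsymIf' : IsMatrixSymmetric fun n => if P n then (0 : MvPolynomial (Fin n × Fin n) ℂ) else f n := by
    intro n σ τ
    by_cases h : P n
    · simp only [if_pos h, map_zero]
    · simp only [if_neg h]; exact hsym n σ τ
  obtain ⟨c₁, hc₁⟩ := affineColSml_restoration _ hsymIf ⟨c, hcol⟩
  obtain ⟨c₂, hc₂⟩ := affineRowSml_restoration _ hsymIf' ⟨c, hrow⟩
  refine ⟨max c₁ c₂, fun n => ?_⟩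
  by_cases h : P n
  · have := hc₁ n
    simp only [if_pos h] at this
    exact Restorable.qpOrbitRestorable_mono (le_max_left _ _) this
  · have := hc₂ n
    simp only [if_neg h] at this
    exact Restorable.qpOrbitRestorable_mono (le_max_right _ _) this

end Summit.ValiantsHypothesis.ValiantsHypothesis.Theorems.SmlAffineRestoration

end
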